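import Summits.QuantumFields.YangMills.Theorems.BalabanUVNodesN07ChartHInvTwistedLetter
import Summits.QuantumFields.YangMills.Theorems.BalabanUVNodesK0Stub1RecordAveragingRightInverse
import Summits.QuantumFields.YangMills.Theorems.BalabanUVNodesN07ChartDDecay
import HarnessLib

/-!
# BalabanUVNodes ∕ N07 — THE ROUTE's CORRECTED RIGHT INVERSE OF THE TRUE LINEARISATION WITH ALL TWISTED (46) LETTERS — part 2 of 2: the packaged bridge
# `exists_rightInverse_twisted`, its `(P, k)` instance on the pinned `flatH` from P2's kernel rows, and [15] PROP. 3 WITH (73)'s DECAY from those rows (generic `P : Params`)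

Cell `pub-ymgap`, width seat `pub-ymgap-dag-n07-w2` generation 4 (D-0149; N07 = [15]; S2 «Prop. 3 at objects», discharge of the twisted letter displayed in `…N07ChartDDecay`).
`--kind proof --supports … --as helper` (K1 face; count-neutral).  CONSUMED BY NAME: part 1 `…N07ChartHInvTwistedLetter.letter_twisted`, the route `UnitScaleTilt`'s
`ChartHInv.{exists_combFamily, exists_tent, main_identity, Y_add, Y_smul, phi_add, phi_smul, exists_linFamily}` — the construction of `ChartHInv.exists_rightInverse` VERBATIM
(so the `H` here IS the route's corrected right inverse `HX = H₀X̃′ + dφ`), with the kernel row of `H₀` replacing its weighted sup letter; `Prop8Chart.fderiv_chartLog_zero_apply`;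
dag k0-s1-w1's `K0Stub1RecordAveragingRightInverse.bondAvgIter_of_isFlatH`; dag k0-s1-w3's `K0FlatCubeOpsTextP.{IsFlatH, IsLevWeight, HKernelRows, RowSum162}`; generation 3's
`N07ChartDDerivative.exists_chartD_hasFDerivAt`, `N07ChartDOfRecord.size_chartA_le`; this seat's `N07ChartDDecay.chartD_fderiv_twisted_le`.

WHAT IS PROVED (sorry-free; no definition; axioms standard).  ★★★ `exists_rightInverse_twisted` — for a nested family `D`, (2.2)-admissible with `2L ≤ R·M + 1`, `η > 0`, the
level weight `w₁`, ANY real right inverse `H₀` of the multi-level straight average whose kernel obeys `|H₀δ_c(b)| ≤ C_Ke^{−δ₀d(b,c)}` (`d ≥ 0`) with the half-rate row sum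
`w₁(b)Σ_c e^{−½δ₀d(b,c)}(L^{j(c)}η)⁻¹ ≤ B₃`, and ANY averaging family `Q^{(0)} = id`, `Q^{(j+1)} = linAvg∘Q^{(j)}`: THERE IS a ℂ-linear `H` with (i) `η·Q^{(j)}(HX)(c) = X(j,c)`
on `𝔅`; (ii) the weighted sup letter `w₁(b)‖HX(b)‖ ≤ C_KB₃(1+2C)(1+2C(1+L))·‖X‖_∞` (the zero twist); (iii) for EVERY twist pair `dE∕dF`, `0 ≤ δ ≤ ½δ₀`, with triangle,
index slack `r₁` and block slack `r₂`: `e^{δdE(b)}w₁(b)‖HX(b)‖ ≤ C_KB₃(1+2Ce^{δr₁})(1+2C(1+L)e^{δr₂})·t` whenever `e^{δdF(c)}‖X(c)‖ ≤ t` — the matrix-fibre, twisted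
form of [15] (46)∕(161) for the route's `H`, i.e. the DISPLAYED letter `hHe` of `N07ChartDDecay.chartD_fderiv_twisted_le`.  §2 ★★★ `exists_rightInverse_chartLog_twisted` — the
`(P, k)` instance: `IsFlatH P k D H₀` (the pinned `GQ*(QGQ*)⁻¹`) + P2's `HKernelRows P k D dBI w H₀ C_K δ₀` ((k1) only) + `RowSum162 P k D dBI w δ₀ B₃` over a bipartite `dBI ≥ 0`
⇒ a ℂ-linear right inverse of `D chartLog(0)` (`η = L^{−k}`) with the sup letter and all twisted letters (dag k0-s1-w1's `exists_rightInverse_chartLog_of_flatH` re-run on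
rows; (162)'s `(d + 1)L^{k−j}` dominates `(Lʲη)⁻¹`).  §3 ★★★ `exists_chartD_decay_of_kernelRows` — END TO END AT `(P, k)`: from P2's rows and the window `18C₂B₀′ε ≤ 1`,
`64ε ≤ R⋆` (`B₀′ = C_KB₃(1+2C)(1+2C(1+L))`): the route's `H`, generation 3's chart map `Dfun` with (55), (49), (48), `HasFDerivAt`, the norm-level (73), AND for every twist
pair `dE∕dF` (rate `0 ≤ δ ≤ ½δ₀`; (s1) triangle against `dBI`, (s2) index slack `r₁`, (s3) block slack `r₂`, (s4) read slack `dF(j,c) ≤ dE(b) + r₀` on the read set) under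
`4C₃e^{δr₀}B_e(δ)ε ≤ 1`: `e^{δ·dF(i)}‖𝔇W i‖ ≤ 4C₃e^{δr₀}ε·t` whenever `e^{δ·dE(b)}w₁(b)‖W b‖ ≤ t` — (73) with its decay, the letter of `H` DISCHARGED from the kernel row.

HONEST FRAMING: count-neutral helper; composition of kernel theorems by name; the record instance (NODE 00's tori, P2's rows from `kernelRowsAt_of_adm22`, slacks against the
physical `distBI`) is the NEXT file `…N07ChartDDecayAtRecord`; the twist itself stays the consumer's; nothing of [15] Sects. D–F asserted; stub 1 ∕ K0⁷ ∕ K1⁸ NOT closed; N07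
NOT discharged; counts unmoved; one finite T⁴ programme at fixed ε — NOT continuum ∕ ℝ⁴ ∕ OS ∕ mass gap ∕ Clay: the Yang–Mills mass gap is NOT proved by any of this; R4
closes the conditional rung `BalabanLadder.UV` only.  No `sorry`, no `def`, no `instance`, no `notation`.

References: [15] T. Bałaban, CMP 102 (1985) 277–309 [Balaban1985Variational] ((45)–(46) p.285, (71) p.289, (156)–(157) p.302, (161)–(162) p.303); [3] = [B6] CMP 96 (1984)
223–250 [Balaban1984PropagatorsII] ((2.1)–(2.4) p.224, (2.20) p.226, Lemma 2.1 p.232, Cor. 2.8 (2.150)–(2.151) p.249); [4] = [B7] CMP 98 (1985) 17–51 [Balaban1985Averaging]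
((62) p.28, (124)–(125) p.36).
-/

noncomputable section

open scoped BigOperators Matrix.Norms.L2Operator

namespace Summit.QuantumFields.YangMills.BalabanUVNodes.N07ChartHInvTwisted

open Literature.MathematicalPhysics.QuantumFieldTheory.Balaban1983to89
open T4Continuum BlockAveraging BlockAveragingEMLLinearised LatticeFieldCalculus
open B5Eq118OneStroke (iterBlockOf iterBlockOf_zero iterBlockOf_succ)
open B15DeterminingSets (embIter)
open B6SectADomainsV1 (Domains)
open B6SectAOperatorsV1 (BondIdx SiteIdx)
open B11Eq115Space (levOf)
open Summit.QuantumFields.YangMills.Theorems (FlatCubeLevels.levOf_inOm_unique FlatCubeLevels.lamSite_levOf_inOm FlatCubeLevels.levOf_inOm_le)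
open Summit.QuantumFields.YangMills.Theorems.FlatCubeOpsText (Adm22)
open Summit.QuantumFields.YangMills.Theorems.Prop8Chart (collar_of_adm22)
open Summit.QuantumFields.YangMills.Theorems.Prop7CombGauge (combMean_add)
open Summit.QuantumFields.YangMills.Theorems.ChartHInv
open Literature.MathematicalPhysics.QuantumFieldTheory.BalabanImbrieJaffe1984to88.BIJ88RT51Background (iterBlockOf_embIter)
open Summit.QuantumFields.YangMills.Theorems.K0FlatCubeOpsTextP (IsFlatH IsLevWeight HKernelRows RowSum162 levWeight_nonneg)
open Summit.QuantumFields.YangMills.Theorems.K0Stub1RecordAveragingRightInverse (bondAvgIter_of_isFlatH)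
open Summit.QuantumFields.YangMills.Theorems.Prop8Chart (chartLog fderiv_chartLog_zero_apply)
open Summit.QuantumFields.YangMills.BalabanUVNodes.N07ChartDDecay (chartD_fderiv_twisted_le)
open Summit.QuantumFields.YangMills.BalabanUVNodes.N07ChartDDerivative (exists_chartD_hasFDerivAt)
open Summit.QuantumFields.YangMills.BalabanUVNodes.N07ChartDOfRecord (size_chartA_le)

variable {P : Params} {n : Type*}

/-! ## Packaging: the ℂ-linear right inverse with its twisted letters (the sup letter as the zero twist) -/

section Package

variable [Fintype n] [DecidableEq n]

/-- ★★★ **THE BRIDGE WITH DECAY: A RIGHT INVERSE OF THE TRUE LINEARISATION FROM ONE OF THE STRAIGHT AVERAGES CARRYING A KERNEL ROW, WITH ALL TWISTED LETTERS.**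
For a nested family `D`, (2.2)-admissible with `2L ≤ R·M + 1`, a scale `η > 0`, the level weight `w₁(b) = L^{j(b₋)}η`, ANY real right inverse `H₀` of the multi-level
straight average on the index bonds whose KERNEL obeys `|H₀δ_c(b)| ≤ C_K·e^{−δ₀d(b,c)}` over a bipartite distance `d ≥ 0` ([Balaban1984PropagatorsII] Cor. 2.8 for
(157); P2's `HKernelRows` (k1)) with the half-rate row sum `w₁(b)·Σ_c e^{−½δ₀d(b,c)}(L^{j(c)}η)⁻¹ ≤ B₃` ((162)), there is a ℂ-linear `H` on matrix data with
`η·Q^{(j)}(HX)(c) = X(j,c)` at every index bond (`Q^{(0)} = id`, `Q^{(j+1)} = linAvg∘Q^{(j)}`) such that FOR EVERY pair of twists `dE` (fine bonds), `dF` (index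
bonds) and `0 ≤ δ ≤ ½δ₀` with the triangle inequality `dE(b) ≤ d(b,c) + dF(c)`, the index slack `dF(i) ≤ dF(c) + r₁` for index bonds sharing a fine site, and the
block slack `dE(b) ≤ dE(b′) + r₂` for `b′` under the territory block of an end-point of `b`:
`e^{δ·dE(b)}·w₁(b)‖HX(b)‖ ≤ C_KB₃(1 + 2Ce^{δr₁})(1 + 2C(1+L)e^{δr₂})·t` whenever `e^{δ·dF(c)}‖X(c)‖ ≤ t` (`C = (d+2)L`); in particular (zero twist) the weighted sup
letter `w₁(b)‖HX(b)‖ ≤ C_KB₃(1+2C)(1+2C(1+L))·‖X‖_∞`. The SAME `H` as the route's `ChartHInv.exists_rightInverse` (comb-corrected data, real kernel of `H₀`, tents).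
[cite: Balaban1985Variational, (45)-(46) p.285, (71) p.289, (156)-(157) p.302, (161)-(162) p.303; Balaban1984PropagatorsII, Lemma 2.1 p.232, Cor. 2.8 (2.150)-(2.151) p.249] -/
theorem exists_rightInverse_twisted (D : Domains P) {R M : ℕ} (hAdm : Adm22 D R M) (hRM : 2 * P.L ≤ R * M + 1) {η : ℝ} (hη : 0 < η)
    (w₁ : PBond P 0 → ℝ) (hw₁ : ∀ b, w₁ b = (P.L : ℝ) ^ levOf (fun i => {z : Site P 0 | D.InOm i z}) D.k b.src * η)
    (H₀ : (BondIdx D → ℝ) →ₗ[ℝ] (PBond P 0 → ℝ)) (hinv : ∀ (X : BondIdx D → ℝ) (i : BondIdx D), bondAvgIter (i.1.1 : ℕ) (H₀ X) i.1.2 = X i)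
    (dBI : PBond P 0 → BondIdx D → ℝ) (hd0 : ∀ b c, 0 ≤ dBI b c) {CK δ₀ B₃ : ℝ} (hCK : 0 ≤ CK) (hB₃ : 0 ≤ B₃)
    (hker : ∀ (c : BondIdx D) (b : PBond P 0), |H₀ (Pi.single c 1) b| ≤ CK * Real.exp (-(δ₀ * dBI b c)))
    (hrow : ∀ b, w₁ b * ∑ c : BondIdx D, Real.exp (-(δ₀ / 2 * dBI b c)) * ((P.L : ℝ) ^ (c.1.1 : ℕ) * η)⁻¹ ≤ B₃) (hδ₀ : 0 ≤ δ₀)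
    (Q : (i : ℕ) → (PBond P 0 → Matrix n n ℂ) → PBond P i → Matrix n n ℂ)
    (hQ0 : ∀ Y, Q 0 Y = Y) (hQs : ∀ (i : ℕ) (Y : PBond P 0 → Matrix n n ℂ) (c : PBond P (i + 1)), Q (i + 1) Y c = linAvg (Q i Y) c) :
    ∃ H : (BondIdx D → Matrix n n ℂ) →ₗ[ℂ] (PBond P 0 → Matrix n n ℂ),
      (∀ (X : BondIdx D → Matrix n n ℂ) (idx : BondIdx D), (η : ℂ) • Q (idx.1.1 : ℕ) (H X) idx.1.2 = X idx) ∧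
      (∀ (X : BondIdx D → Matrix n n ℂ) (t : ℝ), 0 ≤ t → (∀ i, ‖X i‖ ≤ t) → ∀ b : PBond P 0,
        w₁ b * ‖H X b‖ ≤ CK * B₃ * (1 + 2 * ((P.d + 2) * P.L : ℕ)) * (1 + 2 * ((P.d + 2) * P.L : ℕ) * (1 + P.L)) * t) ∧
      ∀ (dE : PBond P 0 → ℝ) (dF : BondIdx D → ℝ) (δ r₁ r₂ : ℝ), 0 ≤ δ → δ ≤ δ₀ / 2 →
        (∀ b c, dE b ≤ dBI b c + dF c) →
        (∀ (i c : BondIdx D) (x : Site P 0),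
          (iterBlockOf (i.1.1 : ℕ) x = i.1.2.src ∨ iterBlockOf (i.1.1 : ℕ) x = i.1.2.tgt) →
          (iterBlockOf (c.1.1 : ℕ) x = c.1.2.src ∨ iterBlockOf (c.1.1 : ℕ) x = c.1.2.tgt) → dF i ≤ dF c + r₁) →
        (∀ (b b' : PBond P 0) (x : Site P 0) (j : ℕ), (x = b.src ∨ x = b.tgt) → j ≤ D.k →
          iterBlockOf j b'.src = iterBlockOf j x → dE b ≤ dE b' + r₂) →
        ∀ (X : BondIdx D → Matrix n n ℂ) (t : ℝ), 0 ≤ t → (∀ c, Real.exp (δ * dF c) * ‖X c‖ ≤ t) → ∀ b : PBond P 0,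
          Real.exp (δ * dE b) * (w₁ b * ‖H X b‖) ≤
            CK * B₃ * (1 + 2 * ((P.d + 2) * P.L : ℕ) * Real.exp (δ * r₁)) * (1 + 2 * ((P.d + 2) * P.L : ℕ) * (1 + P.L) * Real.exp (δ * r₂)) * t := by
  classical
  obtain ⟨Λ, hΛ0, hΛs⟩ := exists_combFamily (P := P) (n := n)
  have htent := fun s : SiteIdx D => exists_tent (P := P) (j := (s.1.1 : ℕ)) ((D.le_of_lamSite s.2).trans D.hk) s.1.2
  choose τ hτ1 hτ0 _hτ01 hτlip using htent
  obtain ⟨Xf, hXf⟩ : ∃ Xf : (BondIdx D → Matrix n n ℂ) → (i : ℕ) → PBond P i → Matrix n n ℂ,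
      ∀ X i b, Xf X i b = if h : D.LamBond i b then X ⟨⟨⟨i, Nat.lt_succ_of_le (D.le_of_lamBond h)⟩, b⟩, h⟩ else 0 := ⟨_, fun _ _ _ => rfl⟩
  obtain ⟨κ, hκ0, hκs⟩ : ∃ κ : (BondIdx D → Matrix n n ℂ) → (j : ℕ) → Site P j → Matrix n n ℂ,
      (∀ X y, κ X 0 y = 0) ∧ ∀ X (i : ℕ) (y : Site P (i + 1)), κ X (i + 1) y = if y ∈ D.Om (i + 1) then 0 else combMean (Xf X i) y :=
    ⟨fun X j => Nat.rec (motive := fun j => Site P j → Matrix n n ℂ) (fun _ => 0)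
      (fun i _ y => if y ∈ D.Om (i + 1) then 0 else combMean (Xf X i) y) j, fun _ _ => rfl, fun _ _ _ => rfl⟩
  obtain ⟨Xt, hXt⟩ : ∃ Xt : (BondIdx D → Matrix n n ℂ) → BondIdx D → Matrix n n ℂ,
      ∀ X idx, Xt X idx = (((P.L : ℝ) ^ (idx.1.1 : ℕ) * η)⁻¹) • (X idx + (κ X idx.1.1 idx.1.2.tgt - κ X idx.1.1 idx.1.2.src)) :=
    ⟨_, fun _ _ => rfl⟩
  obtain ⟨Y, hY⟩ : ∃ Y : (BondIdx D → Matrix n n ℂ) → PBond P 0 → Matrix n n ℂ, ∀ X b, Y X b = ∑ i : BondIdx D, H₀ (Pi.single i 1) b • Xt X i :=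
    ⟨_, fun _ _ => rfl⟩
  obtain ⟨φ, hφ⟩ : ∃ φ : (BondIdx D → Matrix n n ℂ) → Site P 0 → Matrix n n ℂ, ∀ X x, φ X x = ∑ s : SiteIdx D, τ s x • Λ (s.1.1 : ℕ) (Y X) s.1.2 :=
    ⟨_, fun _ _ => rfl⟩
  obtain ⟨Hf, hHf⟩ : ∃ Hf : (BondIdx D → Matrix n n ℂ) → PBond P 0 → Matrix n n ℂ, ∀ X b, Hf X b = Y X b + (φ X b.tgt - φ X b.src) :=
    ⟨_, fun _ _ => rfl⟩
  -- linearity (the route's lemmas)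
  have hadd : ∀ X X', Hf (X + X') = Hf X + Hf X' := fun X X' => funext fun b => by
    rw [Pi.add_apply, hHf, hHf, hHf, Y_add D η Xf hXf κ hκ0 hκs Xt hXt H₀ Y hY,
      phi_add D η Λ hΛ0 hΛs Xf hXf κ hκ0 hκs Xt hXt H₀ Y hY τ φ hφ, phi_add D η Λ hΛ0 hΛs Xf hXf κ hκ0 hκs Xt hXt H₀ Y hY τ φ hφ]
    abel
  have hsmul : ∀ (a : ℂ) X, Hf (a • X) = a • Hf X := fun a X => funext fun b => by
    rw [Pi.smul_apply, hHf, hHf, Y_smul D η Xf hXf κ hκ0 hκs Xt hXt H₀ Y hY,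
      phi_smul D η Λ hΛ0 hΛs Xf hXf κ hκ0 hκs Xt hXt H₀ Y hY τ φ hφ, phi_smul D η Λ hΛ0 hΛs Xf hXf κ hκ0 hκs Xt hXt H₀ Y hY τ φ hφ,
      smul_add, smul_sub]
  let H : (BondIdx D → Matrix n n ℂ) →ₗ[ℂ] (PBond P 0 → Matrix n n ℂ) :=
    { toFun := Hf, map_add' := hadd, map_smul' := hsmul }
  have hRM1 : 1 ≤ R * M := by have := P.hL.2; omega
  -- the twisted letters, for every admissible twist
  have htw : ∀ (dE : PBond P 0 → ℝ) (dF : BondIdx D → ℝ) (δ r₁ r₂ : ℝ), 0 ≤ δ → δ ≤ δ₀ / 2 →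
      (∀ b c, dE b ≤ dBI b c + dF c) →
      (∀ (i c : BondIdx D) (x : Site P 0),
        (iterBlockOf (i.1.1 : ℕ) x = i.1.2.src ∨ iterBlockOf (i.1.1 : ℕ) x = i.1.2.tgt) →
        (iterBlockOf (c.1.1 : ℕ) x = c.1.2.src ∨ iterBlockOf (c.1.1 : ℕ) x = c.1.2.tgt) → dF i ≤ dF c + r₁) →
      (∀ (b b' : PBond P 0) (x : Site P 0) (j : ℕ), (x = b.src ∨ x = b.tgt) → j ≤ D.k →
        iterBlockOf j b'.src = iterBlockOf j x → dE b ≤ dE b' + r₂) →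
      ∀ (X : BondIdx D → Matrix n n ℂ) (t : ℝ), 0 ≤ t → (∀ c, Real.exp (δ * dF c) * ‖X c‖ ≤ t) → ∀ b : PBond P 0,
        Real.exp (δ * dE b) * (w₁ b * ‖Hf X b‖) ≤
          CK * B₃ * (1 + 2 * ((P.d + 2) * P.L : ℕ) * Real.exp (δ * r₁)) * (1 + 2 * ((P.d + 2) * P.L : ℕ) * (1 + P.L) * Real.exp (δ * r₂)) * t :=
    fun dE dF δ r₁ r₂ hδ hδh htri hF hE X t ht hX b =>
      letter_twisted D η Λ hΛ0 hΛs Xf hXf κ hκ0 hκs Xt hXt H₀ Y hY τ hτ0 φ hφ w₁ hw₁ hτlip dBI hd0 hCK hker hrow dE dF hδ hδh htri hF hE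
        hAdm hRM1 hη hB₃ Hf hHf X ht hX b
  refine ⟨H, fun X idx => ?_, fun X t ht hX b => ?_, fun dE dF δ r₁ r₂ hδ hδh htri hF hE X t ht hX b => htw dE dF δ r₁ r₂ hδ hδh htri hF hE X t ht hX b⟩
  · show (η : ℂ) • Q (idx.1.1 : ℕ) (Hf X) idx.1.2 = X idx
    rw [show Hf X = fun b => Y X b + (φ X b.tgt - φ X b.src) from funext (hHf X)]
    exact main_identity D η Q hQ0 hQs Λ hΛ0 hΛs Xf hXf κ hκ0 hκs Xt hXt H₀ hinv Y hY τ hτ1 hτ0 φ hφ hAdm hRM hη.ne' X idx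
  · -- the zero twist: `dE = dF = 0`, `δ = 0`, `r₁ = r₂ = 0`
    show w₁ b * ‖Hf X b‖ ≤ _
    have h := htw (fun _ => 0) (fun _ => 0) 0 0 0 le_rfl (by positivity) (fun b c => by simpa using hd0 b c)
      (fun _ _ _ _ _ => by simp) (fun _ _ _ _ _ _ _ => by simp) X t ht (fun c => by simpa using hX c) b
    simpa using h

end Package

/-! ## §2 The `(P, k)` instance: the pinned flat `H₀ = GQ*(QGQ*)⁻¹` with P2's kernel row (k1) and (162) ⇒ a right inverse of `D chartLog(0)` with all twisted letters -/

section PinnedFlat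

variable [Fintype n] [DecidableEq n]

/-- ★★★ **A RIGHT INVERSE OF THE TRUE LINEARISED MULTI-LEVEL (0.4)-CONSTRAINT `D chartLog(0)` WITH THE KERNEL-DECAY (TWISTED) LETTERS, FROM P2's ROWS** — dag k0-s1-w1's
`exists_rightInverse_chartLog_of_flatH` RE-RUN with the kernel row in place of the sup letter: for a nested family `D` (`D.k = k`), (2.2)-admissible with `2L ≤ R·M + 1`, the
level weights `w` (`IsLevWeight`), the pinned flat `H₀` (`IsFlatH P k D H₀`: `GQ*(QGQ*)⁻¹`), a bipartite distance `dBI ≥ 0` with P2's kernel rows `HKernelRows P k D dBI w H₀ C_K δ₀`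
(only (k1) is used) and the row sum `RowSum162 P k D dBI w δ₀ B₃`: there is a ℂ-linear `H` with `D chartLog(0)∘H = id` (`η = L^{−k}`), the weighted sup letter
`w₁(b)‖HX(b)‖ ≤ C_KB₃(1+2C)(1+2C(1+L))‖X‖_∞` and, for every admissible twist pair (§1 (s1)–(s3)), the twisted letter. [cite: Balaban1985Variational, (45)-(46) p.285, (156)-(157) p.302, (161)-(162) p.303; Balaban1984PropagatorsII, (2.35) p.228, Cor. 2.8 (2.150)-(2.151) p.249] -/
theorem exists_rightInverse_chartLog_twisted (k : ℕ) (D : Domains P) (hDk : D.k = k) {R M : ℕ} (hAdm : Adm22 D R M) (hRM : 2 * P.L ≤ R * M + 1)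
    (w : ℕ → PBond P 0 → ℝ) (hw : IsLevWeight P k D w) (H₀ : (BondIdx D → ℝ) →ₗ[ℝ] (PBond P 0 → ℝ)) (hH₀ : IsFlatH P k D H₀)
    (dBI : PBond P 0 → BondIdx D → ℝ) (hd0 : ∀ b c, 0 ≤ dBI b c) {CK δ₀ B₃ : ℝ} (hCK : 0 ≤ CK) (hδ₀ : 0 ≤ δ₀) (hB₃ : 0 ≤ B₃)
    (hker : HKernelRows P k D dBI w H₀ CK δ₀) (h162 : RowSum162 P k D dBI w δ₀ B₃) :
    ∃ H : (BondIdx D → Matrix n n ℂ) →ₗ[ℂ] (PBond P 0 → Matrix n n ℂ),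
      (∀ X : BondIdx D → Matrix n n ℂ,
          (fderiv ℂ (chartLog (((P.L : ℝ)⁻¹) ^ k) D : (PBond P 0 → Matrix n n ℂ) → BondIdx D → Matrix n n ℂ) 0) (H X) = X) ∧
      (∀ (X : BondIdx D → Matrix n n ℂ) (t : ℝ), 0 ≤ t → (∀ i, ‖X i‖ ≤ t) → ∀ b,
        w 1 b * ‖H X b‖ ≤ CK * B₃ * (1 + 2 * ((P.d + 2) * P.L : ℕ)) * (1 + 2 * ((P.d + 2) * P.L : ℕ) * (1 + P.L)) * t) ∧
      ∀ (dE : PBond P 0 → ℝ) (dF : BondIdx D → ℝ) (δ r₁ r₂ : ℝ), 0 ≤ δ → δ ≤ δ₀ / 2 →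
        (∀ b c, dE b ≤ dBI b c + dF c) →
        (∀ (i c : BondIdx D) (x : Site P 0),
          (iterBlockOf (i.1.1 : ℕ) x = i.1.2.src ∨ iterBlockOf (i.1.1 : ℕ) x = i.1.2.tgt) →
          (iterBlockOf (c.1.1 : ℕ) x = c.1.2.src ∨ iterBlockOf (c.1.1 : ℕ) x = c.1.2.tgt) → dF i ≤ dF c + r₁) →
        (∀ (b b' : PBond P 0) (x : Site P 0) (j : ℕ), (x = b.src ∨ x = b.tgt) → j ≤ D.k →
          iterBlockOf j b'.src = iterBlockOf j x → dE b ≤ dE b' + r₂) →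
        ∀ (X : BondIdx D → Matrix n n ℂ) (t : ℝ), 0 ≤ t → (∀ c, Real.exp (δ * dF c) * ‖X c‖ ≤ t) → ∀ b : PBond P 0,
          Real.exp (δ * dE b) * (w 1 b * ‖H X b‖) ≤
            CK * B₃ * (1 + 2 * ((P.d + 2) * P.L : ℕ) * Real.exp (δ * r₁)) * (1 + 2 * ((P.d + 2) * P.L : ℕ) * (1 + P.L) * Real.exp (δ * r₂)) * t := by
  classical
  obtain ⟨Q, hQ0, hQs⟩ := exists_linFamily (P := P) (n := n)
  have hL0 : (0 : ℝ) < P.L := by exact_mod_cast P.L_pos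
  have hη : 0 < ((P.L : ℝ)⁻¹) ^ k := by positivity
  have hw₁ : ∀ b : PBond P 0, w 1 b = (P.L : ℝ) ^ levOf (fun i => {z : Site P 0 | D.InOm i z}) D.k b.src * ((P.L : ℝ)⁻¹) ^ k := by
    intro b; rw [hw 1 b, pow_one, hDk]
  -- the kernel row (k1), read on `Pi.single`
  have hker' : ∀ (c : BondIdx D) (b : PBond P 0), |H₀ (Pi.single c 1) b| ≤ CK * Real.exp (-(δ₀ * dBI b c)) := fun c b =>
    (hker c (Pi.single c 1) (by simp) (fun c' hc' => by simp [hc']) b).1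
  -- (162) dominates the row sum used by part 1 (`(dBI + 1) ≥ 1`, `(Lʲη)⁻¹ = L^{k−j}` for `j ≤ k`)
  have hrow' : ∀ b, w 1 b * ∑ c : BondIdx D, Real.exp (-(δ₀ / 2 * dBI b c)) * ((P.L : ℝ) ^ (c.1.1 : ℕ) * ((P.L : ℝ)⁻¹) ^ k)⁻¹ ≤ B₃ := by
    intro b
    refine le_trans (mul_le_mul_of_nonneg_left (Finset.sum_le_sum fun c _ => ?_) (levWeight_nonneg hw 1 b)) (h162 b)
    have hjk : (c.1.1 : ℕ) ≤ k := by have := c.1.1.isLt; omega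
    have hpow : ((P.L : ℝ) ^ (c.1.1 : ℕ) * ((P.L : ℝ)⁻¹) ^ k)⁻¹ = (P.L : ℝ) ^ (k - (c.1.1 : ℕ)) := by
      rw [inv_pow, mul_inv, inv_inv, pow_sub₀ _ hL0.ne' hjk, mul_comm]
    rw [hpow, mul_assoc]
    refine mul_le_mul_of_nonneg_left ?_ (Real.exp_pos _).le
    have h1 : (1 : ℝ) ≤ dBI b c + 1 := by linarith [hd0 b c]
    have hLp : 0 ≤ (P.L : ℝ) ^ (k - (c.1.1 : ℕ)) := by positivity
    nlinarith
  obtain ⟨H, hinvC, hsup, htw⟩ := exists_rightInverse_twisted (n := n) D hAdm hRM hη (w 1) hw₁ H₀ (bondAvgIter_of_isFlatH k D H₀ hH₀) dBI hd0 hCK hB₃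
    hker' hrow' hδ₀ Q hQ0 hQs
  refine ⟨H, fun X => funext fun idx => ?_, hsup, htw⟩
  rw [fderiv_chartLog_zero_apply _ D Q hQ0 hQs]
  exact hinvC X idx

end PinnedFlat

/-! ## §3 End to end at `(P, k)`: [15] Prop. 3's chart `D(·)` on the route's `H` built from P2's rows, with (73) in BOTH forms — the decay form for EVERY admissible twist -/

section EndToEnd

variable [Fintype n] [DecidableEq n] [Nonempty n]

/-- ★★★ **[15] PROPOSITION 3 WITH (73)'s DECAY FROM P2's KERNEL ROWS, generic carrier.**  For a nested family `D` (`D.k = k`, `Adm22 D R′ M`, `2L ≤ R′`, `1 ≤ M`), the level weights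
`w`, the pinned flat `H₀` (`IsFlatH`) with P2's `HKernelRows P k D dBI w H₀ C_K δ₀` and `RowSum162 P k D dBI w δ₀ B₃` over a bipartite distance `dBI ≥ 0`, and the window
`18C₂B₀′ε ≤ 1`, `64ε ≤ R⋆` (`B₀′ = C_KB₃(1+2C)(1+2C(1+L))`, `C = (d+2)L`): there are the route's right inverse `H` of `D chartLog(0)` (§2) and generation 3's chart map `Dfun` with
(55), (49), (48), a Fréchet derivative `𝔇` and the norm-level (73) `‖𝔇W i‖ ≤ 4C₃ε·t`, AND for every twist pair `dE∕dF` («distances to a block»), rate `0 ≤ δ ≤ ½δ₀`, with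
(s1) triangle `dE(b) ≤ dBI(b,c) + dF(c)`, (s2) index slack `r₁`, (s3) block slack `r₂`, (s4) read slack `dF(j,c) ≤ dE(b) + r₀` for `b` read by `(j,c)`, under
`4C₃e^{δr₀}B_e(δ)ε ≤ 1` (`B_e(δ) = C_KB₃(1+2Ce^{δr₁})(1+2C(1+L)e^{δr₂})`): **`e^{δ·dF(i)}‖𝔇W i‖ ≤ 4C₃e^{δr₀}ε·t` whenever `e^{δ·dE(b)}w₁(b)‖W b‖ ≤ t`** — (73) «|𝔇(A′; c, b)| ≤
O(1)C₃ε₃ … e^{−½δ₀d(c₋,y)}» for the TRUE constraint, the decay letter of `H` DISCHARGED from [3] Cor. 2.8's kernel row (file `…N07ChartDDecay`'s displayed `hHe`).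
[cite: Balaban1985Variational, (45)-(57) pp.285-287, (68)-(73) pp.288-289, Prop. 3 p.289, (161)-(162) p.303; Balaban1984PropagatorsII, Lemma 2.1 p.232, Cor. 2.8 (2.150)-(2.151) p.249] -/
theorem exists_chartD_decay_of_kernelRows (k : ℕ) {R' M : ℕ} (hR'L : 2 * P.L ≤ R') (hM : 1 ≤ M) (D : Domains P) (hDk : D.k = k) (hAdm : Adm22 D R' M)
    {w : ℕ → PBond P 0 → ℝ} (hw : IsLevWeight P k D w) (H₀ : (BondIdx D → ℝ) →ₗ[ℝ] (PBond P 0 → ℝ)) (hH₀ : IsFlatH P k D H₀)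
    (dBI : PBond P 0 → BondIdx D → ℝ) (hd0 : ∀ b c, 0 ≤ dBI b c) {CK δ₀ B₃ : ℝ} (hCK : 0 ≤ CK) (hδ₀ : 0 ≤ δ₀) (hB₃ : 0 ≤ B₃)
    (hker : HKernelRows P k D dBI w H₀ CK δ₀) (h162 : RowSum162 P k D dBI w δ₀ B₃) {ε : ℝ} (hε : 0 < ε)
    (h18 : 18 * (960 * (((P.d + 2) * P.L : ℕ) : ℝ) * (P.L : ℝ) / (12800 * (((P.d + 2) * P.L : ℕ) : ℝ) ^ 2 * (P.L : ℝ))⁻¹) *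
      (CK * B₃ * (1 + 2 * ((P.d + 2) * P.L : ℕ)) * (1 + 2 * ((P.d + 2) * P.L : ℕ) * (1 + P.L))) * ε ≤ 1)
    (h2 : 64 * ε ≤ (12800 * (((P.d + 2) * P.L : ℕ) : ℝ) ^ 2 * (P.L : ℝ))⁻¹) :
    let η : ℝ := ((P.L : ℝ)⁻¹) ^ k
    let Rs : ℝ := (12800 * (((P.d + 2) * P.L : ℕ) : ℝ) ^ 2 * (P.L : ℝ))⁻¹
    let C₂ : ℝ := 960 * (((P.d + 2) * P.L : ℕ) : ℝ) * (P.L : ℝ) / Rs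
    let C₃ : ℝ := 3840 * (((P.d + 2) * P.L : ℕ) : ℝ) * (P.L : ℝ) / Rs
    let Qlin := (fderiv ℂ (chartLog η D : (PBond P 0 → Matrix n n ℂ) → BondIdx D → Matrix n n ℂ) 0)
    ∃ (H : (BondIdx D → Matrix n n ℂ) →ₗ[ℂ] (PBond P 0 → Matrix n n ℂ)) (Dfun : (PBond P 0 → Matrix n n ℂ) → (BondIdx D → Matrix n n ℂ)),
      (∀ X, Qlin (H X) = X) ∧
      DifferentiableOn ℂ Dfun {A' : PBond P 0 → Matrix n n ℂ | ∀ b, w 1 b * ‖A' b‖ < ε} ∧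
      ∀ A' : PBond P 0 → Matrix n n ℂ, (∀ b, w 1 b * ‖A' b‖ < ε) →
        (∀ (ρ : ℝ), 0 ≤ ρ → (∀ b, w 1 b * ‖A' b‖ ≤ ρ) → ∀ i, ‖Dfun A' i‖ ≤ 4 * C₂ * ρ ^ 2) ∧
        chartLog η D (A' - H (Dfun A')) - Qlin (A' - H (Dfun A')) = Dfun A' ∧
        chartLog η D (A' - H (Dfun A')) = Qlin A' ∧
        ∃ 𝔇 : (PBond P 0 → Matrix n n ℂ) →L[ℂ] (BondIdx D → Matrix n n ℂ), HasFDerivAt Dfun 𝔇 A' ∧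
          (∀ (W : PBond P 0 → Matrix n n ℂ) (t : ℝ), 0 ≤ t → (∀ b, w 1 b * ‖W b‖ ≤ t) → ∀ i, ‖𝔇 W i‖ ≤ 4 * C₃ * ε * t) ∧
          ∀ (dE : PBond P 0 → ℝ) (dF : BondIdx D → ℝ) (δ r₀ r₁ r₂ : ℝ), 0 ≤ δ → δ ≤ δ₀ / 2 →
            (∀ b c, dE b ≤ dBI b c + dF c) →
            (∀ (i c : BondIdx D) (x : Site P 0),
              (iterBlockOf (i.1.1 : ℕ) x = i.1.2.src ∨ iterBlockOf (i.1.1 : ℕ) x = i.1.2.tgt) →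
              (iterBlockOf (c.1.1 : ℕ) x = c.1.2.src ∨ iterBlockOf (c.1.1 : ℕ) x = c.1.2.tgt) → dF i ≤ dF c + r₁) →
            (∀ (b b' : PBond P 0) (x : Site P 0) (j : ℕ), (x = b.src ∨ x = b.tgt) → j ≤ D.k →
              iterBlockOf j b'.src = iterBlockOf j x → dE b ≤ dE b' + r₂) →
            (∀ (idx : BondIdx D) (b : PBond P 0),
              (iterBlockOf (idx.1.1 : ℕ) b.src = idx.1.2.src ∨ iterBlockOf (idx.1.1 : ℕ) b.src = idx.1.2.tgt) →
              (iterBlockOf (idx.1.1 : ℕ) b.tgt = idx.1.2.src ∨ iterBlockOf (idx.1.1 : ℕ) b.tgt = idx.1.2.tgt) → dF idx ≤ dE b + r₀) →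
            4 * C₃ * Real.exp (δ * r₀) *
                (CK * B₃ * (1 + 2 * ((P.d + 2) * P.L : ℕ) * Real.exp (δ * r₁)) * (1 + 2 * ((P.d + 2) * P.L : ℕ) * (1 + P.L) * Real.exp (δ * r₂))) * ε ≤ 1 →
            ∀ (W : PBond P 0 → Matrix n n ℂ) (t : ℝ), 0 ≤ t → (∀ b, Real.exp (δ * dE b) * (w 1 b * ‖W b‖) ≤ t) →
              ∀ i, Real.exp (δ * dF i) * ‖𝔇 W i‖ ≤ 4 * C₃ * Real.exp (δ * r₀) * ε * t := by
  intro η Rs C₂ C₃ Qlin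
  have hL0 : (0 : ℝ) < P.L := by exact_mod_cast P.L_pos
  have hℓ1 : (1 : ℝ) ≤ (((P.d + 2) * P.L : ℕ) : ℝ) := by
    exact_mod_cast Nat.one_le_iff_ne_zero.mpr (Nat.mul_ne_zero (by omega) (by have := P.hL.2; omega))
  have hden : 0 < 12800 * (((P.d + 2) * P.L : ℕ) : ℝ) ^ 2 * (P.L : ℝ) := by positivity
  have hRs0 : 0 < Rs := inv_pos.mpr hden
  have hC₂ : 0 ≤ C₂ := by show 0 ≤ 960 * (((P.d + 2) * P.L : ℕ) : ℝ) * (P.L : ℝ) / Rs; positivity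
  have hwpos : ∀ b, 0 < w 1 b := fun b => by rw [hw 1 b, pow_one]; positivity
  have hRM : 2 * P.L ≤ R' * M + 1 := by have : R' ≤ R' * M := Nat.le_mul_of_pos_right R' hM; omega
  have hcollar := collar_of_adm22 D hAdm hRM
  set B₀' : ℝ := CK * B₃ * (1 + 2 * ((P.d + 2) * P.L : ℕ)) * (1 + 2 * ((P.d + 2) * P.L : ℕ) * (1 + P.L)) with hB₀'
  have hB₀'0 : 0 ≤ B₀' := by positivity
  obtain ⟨H, hHinv, hsup, htw⟩ := exists_rightInverse_chartLog_twisted (n := n) k D hDk hAdm hRM w hw H₀ hH₀ dBI hd0 hCK hδ₀ hB₃ hker h162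
  have hsup' : ∀ (X : BondIdx D → Matrix n n ℂ) (t : ℝ), 0 ≤ t → (∀ i, ‖X i‖ ≤ t) → ∀ b, w 1 b * ‖H X b‖ ≤ B₀' * t := hsup
  obtain ⟨Dfun, hdiff, hDfun⟩ := exists_chartD_hasFDerivAt k hR'L hM D hDk hAdm hw H hHinv hB₀'0 hsup' hε h18 h2
  refine ⟨H, Dfun, hHinv, hdiff, fun A' hA' => ?_⟩
  obtain ⟨h55, h49, h48, 𝔇, h𝔇, h73⟩ := hDfun A' hA'
  refine ⟨h55, h49, h48, 𝔇, h𝔇, h73, fun dE dF δ r₀ r₁ r₂ hδ hδh htri hF hE hread hsmall W t ht hW i => ?_⟩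
  -- (57): the chart point has weighted size `≤ 2ε`
  have h4 : 4 * C₂ * B₀' * ε ≤ 1 := by
    have h18' : 18 * C₂ * B₀' * ε ≤ 1 := h18
    nlinarith [mul_nonneg (mul_nonneg hC₂ hB₀'0) hε.le]
  have hX₀ : ∀ b, w 1 b * ‖(A' - H (Dfun A')) b‖ ≤ 2 * ε := fun b => by
    have h := size_chartA_le hwpos H hC₂ hB₀'0 hsup' (fun b => (hA' b).le) (h55 ε hε.le fun b => (hA' b).le) b
    have : B₀' * (4 * C₂ * ε ^ 2) ≤ ε := by nlinarith [mul_nonneg (mul_nonneg hC₂ hB₀'0) hε.le]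
    linarith
  have h16 : 16 * ε ≤ Rs := by show 16 * ε ≤ (12800 * (((P.d + 2) * P.L : ℕ) : ℝ) ^ 2 * (P.L : ℝ))⁻¹; linarith
  -- the exponential twists are read-compatible with `κ = e^{δr₀}`
  have hκ : ∀ (idx : BondIdx D) (b : PBond P 0),
      (iterBlockOf (idx.1.1 : ℕ) b.src = idx.1.2.src ∨ iterBlockOf (idx.1.1 : ℕ) b.src = idx.1.2.tgt) →
      (iterBlockOf (idx.1.1 : ℕ) b.tgt = idx.1.2.src ∨ iterBlockOf (idx.1.1 : ℕ) b.tgt = idx.1.2.tgt) →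
      Real.exp (δ * dF idx) ≤ Real.exp (δ * r₀) * Real.exp (δ * dE b) := by
    intro idx b hs ht'
    rw [← Real.exp_add]
    exact Real.exp_le_exp.mpr (by nlinarith [mul_le_mul_of_nonneg_left (hread idx b hs ht') hδ])
  have hBe : 0 ≤ CK * B₃ * (1 + 2 * ((P.d + 2) * P.L : ℕ) * Real.exp (δ * r₁)) * (1 + 2 * ((P.d + 2) * P.L : ℕ) * (1 + P.L) * Real.exp (δ * r₂)) := by
    positivity
  exact chartD_fderiv_twisted_le k D hDk hcollar hw H hε h16 Dfun (fun A hA => (hDfun A hA).2.1) hA' hX₀ h𝔇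
    (fun b => Real.exp (δ * dE b)) (fun c => Real.exp (δ * dF c)) (fun b => Real.exp_pos _) (fun c => Real.exp_pos _) (Real.exp_pos _).le hκ hBe
    (htw dE dF δ r₁ r₂ hδ hδh htri hF hE) hsmall W t ht hW i

end EndToEnd

end Summit.QuantumFields.YangMills.BalabanUVNodes.N07ChartHInvTwisted

end
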